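import Summits.ResolutionOfSingularities.ResolutionOfSingularities.Theorems.PurelyInseparableDim4PureLeafFpMoves
import HarnessLib
import HarnessLib.Audit.Tags

/-!
# Purely inseparable fourfolds — `p`-ADIC DIGITS of the general form, the SINGLETON CRITERION and the MEASURE over `𝔽_p`
# (cell res-dim4-pi; D3c kit H of `HOME/res-dim4-p-10/D3c-PAPER.md` §3: which coordinate centres are permissible)
# [OURS · counted 0 · bookkeeping identities of OUR frame, not about resolution]

Width seat `res-dim4-p-10` (g3).  For the general form `expand p N(n)·(N(μ) − C γ₀)` of kits F/G:

* §1 `coeff_expand_mul_of_lt` — `p`-adic digits: `coeff_{p·e + v} (expand p E · B) = coeff_e E · coeff_v B` when the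
  monomials of `B` and `v` are `< p` in every variable (the bracket `N(μ) − C γ₀` is such a `B`: `apply_lt_of_mem_support_bracket`);
* §2 the linear coefficients of the bracket (`coeff_single_splitForm`, `coeff_single_bracket_ne_zero`) and
  **`ordAlong_singleton_generalForm_le_one`**: in the bracket regime (all active roots non-zero, some variable active) a
  variable WITHOUT an `x_j^p` in the `p`-th-power part (`n j 0 = 0`) has `ord_{(x_j)} ≤ 1` — so the permissible singletons
  are exactly the `{x_j}` with `n j 0 ≥ 1` (`le_ordAlong_singleton_generalForm` of kit G is the converse);
* §3 the measure `W(n, μ) = Σᵢ Σ_c (p·n i c + μ i c)`: invariant under root shifts (`weight_shift`), `− p` under the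
  singleton chart (`weight_singleton_chart`), strictly smaller under a minimal permissible block chart (`weight_block_chart_lt`).

Nothing here proves resolution of singularities in dimension ≥ 4 / characteristic `p`; counted 0; AI work, weaker than
expert review. bears_on: LADDER-RESOLUTION:D157-DOOR2 (res-dim4-pi · D3c kit H). Supports stmt-ResolutionOfSingularities-16155
(helper).
-/

set_option linter.dupNamespace false

open MvPolynomial Finset

open scoped BigOperators

noncomputable section

namespace Summit.ResolutionOfSingularities.ResolutionOfSingularities.Theorems.PIDim4

namespace PureLeafNF

open Literature.AlgebraicGeometry.Resolution
open Literature.AlgebraicGeometry.Resolution.Hauser2010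
open CentreBlowup PthPowerFactor

variable {σ : Type*} [Fintype σ] [DecidableEq σ] (p : ℕ) [Fact p.Prime]

/-! ## 1. `p`-adic digits of the general form -/

omit [Fintype σ] [DecidableEq σ] [Fact p.Prime] in
/-- Digits are unique: `q·k + y = q·e + v` with `y, v < q` forces `k = e` and `y = v`. [folklore] -/
theorem digit_unique {q k y e v : ℕ} (hq : 0 < q) (hy : y < q) (hv : v < q) (h : q * k + y = q * e + v) :
    k = e ∧ y = v := by
  have hk : (y + q * k) / q = k := by rw [Nat.add_mul_div_left y k hq, Nat.div_eq_of_lt hy, zero_add]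
  have he : (v + q * e) / q = e := by rw [Nat.add_mul_div_left v e hq, Nat.div_eq_of_lt hv, zero_add]
  have hke : k = e := by
    rw [← hk, ← he, add_comm y, add_comm v, h]
  subst hke
  exact ⟨rfl, by omega⟩

omit [Fintype σ] [Fact p.Prime] in
/-- **`p`-adic digits**: `coeff_{q·e + v} (expand q E · B) = coeff_e E · coeff_v B` when every monomial of `B` and `v` itself are
`< q` in every variable. [folklore] -/
theorem coeff_expand_mul_of_lt {L : Type*} [CommRing L] {q : ℕ} (hq : 0 < q) (E B : MvPolynomial σ L) (e v : σ →₀ ℕ)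
    (hB : ∀ w ∈ B.support, ∀ i, w i < q) (hv : ∀ i, v i < q) :
    coeff (q • e + v) (expand q E * B) = coeff e E * coeff v B := by
  classical
  have hmem : (q • e, v) ∈ Finset.antidiagonal (q • e + v) := Finset.mem_antidiagonal.mpr rfl
  rw [coeff_mul, ← Finset.add_sum_erase _ _ hmem, coeff_expand_smul q hq.ne', Finset.sum_eq_zero, add_zero]
  rintro ⟨x, y⟩ hxy'
  obtain ⟨hne, hxy⟩ := Finset.mem_erase.mp hxy'
  show coeff x (expand q E) * coeff y B = 0
  by_cases hy : coeff y B = 0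
  · rw [hy, mul_zero]
  · have hyB : y ∈ B.support := MvPolynomial.mem_support_iff.mpr hy
    by_cases hx : ∀ i, q ∣ x i
    · exfalso
      apply hne
      have hsum : x + y = q • e + v := Finset.mem_antidiagonal.mp hxy
      have hxy2 : ∀ i, x i = q * e i ∧ y i = v i := fun i => by
        have h := DFunLike.congr_fun hsum i
        simp only [Finsupp.add_apply, Finsupp.smul_apply, smul_eq_mul] at h
        obtain ⟨k, hk⟩ := hx i
        rw [hk] at h
        obtain ⟨h1, h2⟩ := digit_unique hq (hB y hyB i) (hv i) h
        exact ⟨by rw [hk, h1], h2⟩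
      have hx' : x = q • e := by
        ext i; rw [Finsupp.smul_apply, smul_eq_mul]; exact (hxy2 i).1
      have hy' : y = v := by
        ext i; exact (hxy2 i).2
      rw [hx', hy']
    · push Not at hx
      obtain ⟨i, hi⟩ := hx
      rw [coeff_expand_of_not_dvd E hi, zero_mul]

omit [Fintype σ] in
/-- Monomials of a product of linear powers, one per variable of `s`, are bounded by the exponents. [folklore] -/
theorem apply_le_of_mem_support_prod_linearPow {L : Type*} [CommRing L] [Nontrivial L] (s : Finset σ) (r : σ → L)
    (d : σ → ℕ) {w : σ →₀ ℕ} (hw : w ∈ (∏ k ∈ s, (X k + C (r k)) ^ d k : MvPolynomial σ L).support) (i : σ) :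
    w i ≤ if i ∈ s then d i else 0 := by
  classical
  induction s using Finset.induction_on generalizing w with
  | empty =>
    rw [Finset.prod_empty] at hw
    have : w = 0 := by
      by_contra h
      rw [MvPolynomial.mem_support_iff, ← C_1, coeff_C, if_neg (Ne.symm h)] at hw
      exact hw rfl
    rw [this, Finsupp.coe_zero, Pi.zero_apply]
    exact Nat.zero_le _
  | insert j s hjs ih =>
    rw [Finset.prod_insert hjs] at hw
    obtain ⟨u, hu, v, hv, rfl⟩ := Finset.mem_add.mp (support_mul _ _ hw)
    obtain ⟨hus, hule⟩ := eq_single_of_mem_support_linearPow j (r j) (d j) hu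
    have hih := ih hv
    rw [Finsupp.add_apply, hus, Finsupp.single_apply]
    by_cases hij : j = i
    · subst hij
      rw [if_pos rfl, if_pos (Finset.mem_insert_self j s)]
      rw [if_neg hjs] at hih
      omega
    · rw [if_neg hij, zero_add]
      by_cases his : i ∈ s
      · rw [if_pos his] at hih; rw [if_pos (Finset.mem_insert_of_mem his)]; exact hih
      · rw [if_neg his] at hih
        rw [if_neg (fun h => by rcases Finset.mem_insert.mp h with h | h; exact hij h.symm; exact his h)]
        exact hih

/-- **The bracket has small monomials**: every monomial of `N(μ) − C γ₀` (single-rooted `μ < p`) is `< p` in every variable.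
[folklore] -/
theorem apply_lt_of_mem_support_bracket (μ : σ → ZMod p → ℕ) (γ₀ : ZMod p) (hμ : ∀ i c, μ i c < p)
    (r : σ → ZMod p) (hr : ∀ i c, μ i c ≠ 0 → r i = c) {w : σ →₀ ℕ}
    (hw : w ∈ ((∏ i, ∏ c, (X i + C c) ^ μ i c : MvPolynomial σ (ZMod p)) - C γ₀).support) (i : σ) : w i < p := by
  rw [splitForm_eq_prod_linearPow p μ r hr] at hw
  rcases Finset.mem_union.mp (MvPolynomial.support_sub σ _ _ hw) with h | h
  · have := apply_le_of_mem_support_prod_linearPow Finset.univ r (fun k => μ k (r k)) h i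
    rw [if_pos (Finset.mem_univ i)] at this
    exact lt_of_le_of_lt this (hμ i (r i))
  · have h0 : w = 0 := by
      by_contra hne
      rw [MvPolynomial.mem_support_iff, coeff_C, if_neg (Ne.symm hne)] at h
      exact h rfl
    rw [h0, Finsupp.coe_zero, Pi.zero_apply]
    exact (Fact.out : p.Prime).pos

/-! ## 2. Linear coefficients of the bracket and the singleton criterion -/

/-- The linear coefficients of a single-rooted split form: `coeff eᵢ N(μ) = ∏_k C(μ_k, δᵢₖ)·r_k^{μ_k − δᵢₖ}`. [folklore] -/
theorem coeff_single_splitForm (μ : σ → ZMod p → ℕ) (r : σ → ZMod p) (hr : ∀ i c, μ i c ≠ 0 → r i = c) (i : σ) :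
    coeff (Finsupp.single i 1) (∏ k, ∏ c, (X k + C c) ^ μ k c : MvPolynomial σ (ZMod p)) =
      ∏ k, (((μ k (r k)).choose (Finsupp.single i 1 k) : ZMod p) * r k ^ (μ k (r k) - Finsupp.single i 1 k)) := by
  rw [splitForm_eq_prod_linearPow p μ r hr, WeightedBlowup.coeff_prod_X_add_C_pow]

/-- **The bracket has a non-zero linear term at every active variable** (active roots non-zero, `μ < p`). [folklore] -/
theorem coeff_single_bracket_ne_zero (μ : σ → ZMod p → ℕ) (γ₀ : ZMod p) (hμ : ∀ i c, μ i c < p)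
    (h1 : ∀ i c, μ i c ≠ 0 → ∀ c', c' ≠ c → μ i c' = 0) (hact : ∀ i c, μ i c ≠ 0 → c ≠ 0)
    {i₀ : σ} {c₀ : ZMod p} (hi₀ : μ i₀ c₀ ≠ 0) :
    coeff (Finsupp.single i₀ 1) ((∏ k, ∏ c, (X k + C c) ^ μ k c : MvPolynomial σ (ZMod p)) - C γ₀) ≠ 0 := by
  classical
  let r : σ → ZMod p := fun i => if h : ∃ c, μ i c ≠ 0 then h.choose else 0
  have hr : ∀ i c, μ i c ≠ 0 → r i = c := fun i c hc => by
    have hex : ∃ c, μ i c ≠ 0 := ⟨c, hc⟩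
    have hri : r i = hex.choose := dif_pos hex
    rw [hri]
    by_contra hne
    exact hex.choose_spec (h1 i c hc _ hne)
  rw [coeff_sub, coeff_C, if_neg (Finsupp.single_ne_zero.mpr one_ne_zero).symm, sub_zero,
    coeff_single_splitForm p μ r hr i₀]
  refine Finset.prod_ne_zero_iff.mpr fun k _ => ?_
  by_cases hk : k = i₀
  · subst hk
    have hrk : r k = c₀ := hr k c₀ hi₀
    rw [Finsupp.single_eq_same, Nat.choose_one_right, hrk]
    refine mul_ne_zero ?_ (pow_ne_zero _ (hact k c₀ hi₀))
    rw [Ne, ZMod.natCast_eq_zero_iff]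
    exact fun hdvd => absurd (Nat.le_of_dvd (Nat.pos_of_ne_zero hi₀) hdvd) (not_le.mpr (hμ k c₀))
  · rw [Finsupp.single_eq_of_ne hk, Nat.choose_zero_right, Nat.cast_one, one_mul, Nat.sub_zero]
    by_cases h0 : μ k (r k) = 0
    · rw [h0, pow_zero]; exact one_ne_zero
    · exact pow_ne_zero _ (hact k (r k) h0)

/-- **THE SINGLETON CRITERION in the bracket regime**: if all active roots are non-zero, some variable is active, and
`n j 0 = 0`, then `ord_{(x_j)}` of the general form is `≤ 1` — the centre `{x_j}` is NOT permissible. (Witness monomial: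
`x^{p·corner(n)} · x_{i₀}`.) [folklore] -/
theorem ordAlong_singleton_generalForm_le_one (n μ : σ → ZMod p → ℕ) (γ₀ : ZMod p) (hμ : ∀ i c, μ i c < p)
    (h1 : ∀ i c, μ i c ≠ 0 → ∀ c', c' ≠ c → μ i c' = 0) (hact : ∀ i c, μ i c ≠ 0 → c ≠ 0)
    {i₀ : σ} {c₀ : ZMod p} (hi₀ : μ i₀ c₀ ≠ 0) {j : σ} (hj : n j 0 = 0) :
    ordAlong {j} (expand p (∏ k, ∏ c, (X k + C c) ^ n k c : MvPolynomial σ (ZMod p)) *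
        ((∏ k, ∏ c, (X k + C c) ^ μ k c) - C γ₀)) ≤ 1 := by
  classical
  let r : σ → ZMod p := fun i => if h : ∃ c, μ i c ≠ 0 then h.choose else 0
  have hr : ∀ i c, μ i c ≠ 0 → r i = c := fun i c hc => by
    have hex : ∃ c, μ i c ≠ 0 := ⟨c, hc⟩
    have hri : r i = hex.choose := dif_pos hex
    rw [hri]
    by_contra hne
    exact hex.choose_spec (h1 i c hc _ hne)
  have hcoeff : coeff (p • (Finsupp.equivFunOnFinite.symm fun i => n i 0) + Finsupp.single i₀ 1)
      (expand p (∏ k, ∏ c, (X k + C c) ^ n k c : MvPolynomial σ (ZMod p)) *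
        ((∏ k, ∏ c, (X k + C c) ^ μ k c) - C γ₀)) ≠ 0 := by
    rw [coeff_expand_mul_of_lt (Fact.out : p.Prime).pos _ _ _ _
      (fun w hw i => apply_lt_of_mem_support_bracket p μ γ₀ hμ r hr hw i)
      (fun i => by rw [Finsupp.single_apply]; split_ifs; exact (Fact.out : p.Prime).one_lt; exact (Fact.out : p.Prime).pos),
      coeff_corner_splitForm]
    refine mul_ne_zero ?_ (coeff_single_bracket_ne_zero p μ γ₀ hμ h1 hact hi₀)
    exact Finset.prod_ne_zero_iff.mpr fun i _ => Finset.prod_ne_zero_iff.mpr fun c hc =>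
      pow_ne_zero _ (Finset.ne_of_mem_erase hc)
  refine le_trans (ordAlong_le_of_coeff_ne_zero (S := {j}) hcoeff) ?_
  rw [degIn_singleton, Finsupp.add_apply, Finsupp.smul_apply, smul_eq_mul, Finsupp.single_apply]
  have : (Finsupp.equivFunOnFinite.symm fun i => n i 0) j = n j 0 := rfl
  rw [this, hj, mul_zero, zero_add]
  split_ifs <;> simp

/-! ## 3. The measure `W(n, μ) = Σᵢ Σ_c (p·n i c + μ i c)` -/

omit [DecidableEq σ] in
/-- Root shifts keep the measure. [folklore] -/
theorem weight_shift (n μ : σ → ZMod p → ℕ) (b : σ → ZMod p) :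
    ∑ i, ∑ c, (p * n i (c - b i) + μ i (c - b i)) = ∑ i, ∑ c, (p * n i c + μ i c) :=
  Finset.sum_congr rfl fun i _ =>
    Fintype.sum_equiv (Equiv.subRight (b i)) _ _ fun c => by simp [Equiv.subRight]

/-- The singleton chart lowers the measure by `p`. [folklore] -/
theorem weight_singleton_chart (n μ : σ → ZMod p → ℕ) {j : σ} (hj : 1 ≤ n j 0) :
    ∑ i, ∑ c, (p * (if i = j ∧ c = 0 then n j 0 - 1 else n i c) + μ i c) + p = ∑ i, ∑ c, (p * n i c + μ i c) := by
  have hsplit : ∀ f : σ → ZMod p → ℕ, ∑ i, ∑ c, f i c =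
      f j 0 + (∑ c ∈ Finset.univ.erase 0, f j c + ∑ i ∈ Finset.univ.erase j, ∑ c, f i c) := fun f => by
    rw [← Finset.add_sum_erase Finset.univ _ (Finset.mem_univ j),
      ← Finset.add_sum_erase Finset.univ _ (Finset.mem_univ (0 : ZMod p)), add_assoc]
  rw [hsplit (fun i c => p * (if i = j ∧ c = 0 then n j 0 - 1 else n i c) + μ i c), hsplit (fun i c => p * n i c + μ i c)]
  have h1 : ∑ c ∈ Finset.univ.erase (0 : ZMod p), (p * (if j = j ∧ c = 0 then n j 0 - 1 else n j c) + μ j c) =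
      ∑ c ∈ Finset.univ.erase (0 : ZMod p), (p * n j c + μ j c) :=
    Finset.sum_congr rfl fun c hc => by rw [if_neg (fun h => Finset.ne_of_mem_erase hc h.2)]
  have h2 : ∑ i ∈ Finset.univ.erase j, ∑ c, (p * (if i = j ∧ c = 0 then n j 0 - 1 else n i c) + μ i c) =
      ∑ i ∈ Finset.univ.erase j, ∑ c, (p * n i c + μ i c) :=
    Finset.sum_congr rfl fun i hi => Finset.sum_congr rfl fun c _ => by
      rw [if_neg (fun h => Finset.ne_of_mem_erase hi h.1)]
  rw [h1, h2, if_pos ⟨rfl, rfl⟩]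
  have : p * (n j 0 - 1) + p = p * n j 0 := by
    rw [Nat.mul_sub, mul_one, Nat.sub_add_cancel (Nat.le_mul_of_pos_right p hj)]
  omega

/-- The block chart `μ j 0 ↦ Σ_S μ i 0 − p` lowers the measure when the block is minimal (`Σ_{S∖j} μ i 0 < p`). [folklore] -/
theorem weight_block_chart_lt (n μ : σ → ZMod p → ℕ) (S : Finset σ) {j : σ} (hj : j ∈ S)
    (hp : p ≤ ∑ i ∈ S, μ i 0) (hmin : (∑ i ∈ S.erase j, μ i 0) < p) :
    ∑ i, ∑ c, (p * n i c + (if i = j ∧ c = 0 then (∑ i ∈ S, μ i 0) - p else μ i c)) <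
      ∑ i, ∑ c, (p * n i c + μ i c) := by
  have hsplit : ∀ f : σ → ZMod p → ℕ, ∑ i, ∑ c, f i c =
      f j 0 + (∑ c ∈ Finset.univ.erase 0, f j c + ∑ i ∈ Finset.univ.erase j, ∑ c, f i c) := fun f => by
    rw [← Finset.add_sum_erase Finset.univ _ (Finset.mem_univ j),
      ← Finset.add_sum_erase Finset.univ _ (Finset.mem_univ (0 : ZMod p)), add_assoc]
  rw [hsplit (fun i c => p * n i c + (if i = j ∧ c = 0 then (∑ i ∈ S, μ i 0) - p else μ i c)),
    hsplit (fun i c => p * n i c + μ i c)]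
  have h1 : ∑ c ∈ Finset.univ.erase (0 : ZMod p), (p * n j c + (if j = j ∧ c = 0 then (∑ i ∈ S, μ i 0) - p else μ j c)) =
      ∑ c ∈ Finset.univ.erase (0 : ZMod p), (p * n j c + μ j c) :=
    Finset.sum_congr rfl fun c hc => by rw [if_neg (fun h => Finset.ne_of_mem_erase hc h.2)]
  have h2 : ∑ i ∈ Finset.univ.erase j, ∑ c, (p * n i c + (if i = j ∧ c = 0 then (∑ i ∈ S, μ i 0) - p else μ i c)) =
      ∑ i ∈ Finset.univ.erase j, ∑ c, (p * n i c + μ i c) :=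
    Finset.sum_congr rfl fun i hi => Finset.sum_congr rfl fun c _ => by
      rw [if_neg (fun h => Finset.ne_of_mem_erase hi h.1)]
  rw [h1, h2, if_pos ⟨rfl, rfl⟩]
  have hS : μ j 0 + ∑ i ∈ S.erase j, μ i 0 = ∑ i ∈ S, μ i 0 := Finset.add_sum_erase S (fun i => μ i 0) hj
  omega

end PureLeafNF

end Summit.ResolutionOfSingularities.ResolutionOfSingularities.Theorems.PIDim4

end
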